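import Summits.FinalStateConjecture.FinalStateConjecture.Theses.PhaseMixingCapture
import Literature.Geometry.Lorentzian.ApproximateKerrConfiguration
import Literature.Geometry.Lorentzian.EventHorizonAreaLaw
import Literature.Geometry.Lorentzian.BondiMassCauchy

/-!
# Line `parking-starves-the-hole` for the crux `PhaseMixingCapture.CaptureSuffices`
# (stmt-FinalStateConjecture-9953) — crux-plan, round 1

`CaptureSuffices := NearExtremalKappaCapture → BulkKerrCapture → WeakCosmicCensorshipMGHD →
FinalStateConjecture` is the whole large-data FRONT END of route PhaseMixingCapture.  This line
is the route's own layer-2 plan `QuietWindowApproach → NoExtremalParking → capture`, with the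
middle node supplied by the card's lever in its GENERAL-SECTOR form (the three triage notes agree
that the theorem-shaped axisymmetric starvation — Komar `J` conserved, Dain–Reiris floor
`A ≥ 8π|J|`, saturation ⇒ exactly non-expanding horizon — is a MODEL-SECTOR statement, and that
for the crux, which is Christodoulou-generic over ALL admissible data, the usable output is the
one-instant certificate plus a kick):

* two classical monotone charges of a censored development — the area `A_𝓗(v)` of the cuts of
  the intrinsic event horizon `𝓗⁺ = ∂J⁻(𝓘⁺)` along an advanced-time foliation
  (`EventHorizonArea`, non-decreasing by the Chruściel–Delay–Galloway–Howard area theorem,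
  tree: `VacuumCauchyDevelopment.monotone_horizonArea_of_achronalBoundary`) and the Bondi mass
  `M_B(u)` of a canonical Bondi foliation (`DataEmbedding.BondiFoliation.IsCanonical`,
  non-increasing: `bondiMass_antitone`) — pinch exactly at extremality: a development that
  approaches the Kerr family along windows and PARKS (`1 − a²/M² → 0`) has
  `A_𝓗(v) ≤ A_∞ = 8π M_f² ≤ 8π M_B(u)²` for EVERY pair of cuts `(v, u)`:
  **parking starves the hole** — the extremal Penrose inequality holds at all pairs of times
  (`Starved`, stub `stub_parkingStarves`), so ONE fed instant `A_𝓗(v) > 8π M_B(u)²` (`Fed`)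
  excludes parking forever, with no post-kick evolution theory;
* the remaining three stubs are the honest remainder of every late-time line on this crux:
  orbital approach along windows (`stub_quietWindowApproach`), genericity of being fed / of the
  margin (`stub_fedOrMarginGeneric`: the unparking kick of card kick-lifts-the-slice-edge, the
  diagonal ∧-surgery of card capture-exports-censorship-diagonal-surgery, and — declared, without
  mechanism — the multi-horizon regime), and conversion of a margin into settling by the capture
  hypotheses (`stub_marginCapture`: adapter of card quiet-past-cone-surgery + Kerr capture; the
  only stub that consumes `NearExtremalKappaCapture`/`BulkKerrCapture`).

`CaptureSuffices_of : stub-statements → CaptureSuffices` is proved below WITHOUT `sorry`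
(monotonicity of Christodoulou genericity + the pigeonhole `¬ Margin → ParksSingle ∨ ParksMulti`).

Disproof used (cdisprove cycle 1, `Cruxes/CaptureSuffices/Disproof.lean`, read in full; it has NO
`_false_without_` theorem and no landed `Negative/` lemma yet): `not_captureSuffices_witness` —
every counterexample is an admissible CENSORED datum with a non-decomposable MGHD; the four
predicates below are properties of exactly such objects.  `captureSuffices_iff_sharp` (§B: the
capture hypotheses are worth only their adversarial witnesses `k = 0`, `δ ≥ δ₀`, `γ ≥ γ₀`) and
§D (mass pinning for `δ ≥ −1/2`) bite ONLY `stub_marginCapture`, the one stub fed by the capture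
hypotheses, and are recorded in its docstring (dead as typed at late times without the owner's
numeral repair `k := 2`, `δ < −1/2` or the quiet-past adapter); stubs 1–3 consume `W` only.
`without_wcc_iff`: censorship is used genuinely (event horizon, area theorem, MOTS ⊂ 𝓑).
-/

noncomputable section

set_option linter.dupNamespace false

namespace Summit.FinalStateConjecture.FinalStateConjecture.Cruxes.CaptureSuffices.ParkingStarvesTheHole

open Set Filter Function Topology
open scoped Manifold ContDiff ENNReal
open Literature.Geometry.Lorentzian
open Summit.FinalStateConjecture.FinalStateConjecture.Theses

variable {X : Type} [TopologicalSpace X] [ChartedSpace E3 X] [IsManifold (𝓡 3) ∞ X]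

/-! ## §1 Data-level predicates (verbatim pieces of the summit statement) -/

section DataLevel

variable [ConnectedSpace X]

/-- `D` is **censored**: it has a maximal vacuum Cauchy development and every MGHD has complete
future null infinity (sojourn form) — verbatim the property made generic by
`WeakCosmicCensorshipMGHD`. -/
def Censored (D : InitialDataSet (𝓡 3) X) : Prop :=
  (∃ 𝒟 : VacuumCauchyDevelopment D, 𝒟.IsMaximal) ∧
    ∀ 𝒟 : VacuumCauchyDevelopment D, 𝒟.IsMaximal →
      Summit.FinalStateConjecture.HasCompleteNullInfinity 𝒟.toCauchyDevelopment

/-- `D` **settles**: verbatim the matrix of `FinalStateConjecture` (MGHD exists; every MGHD has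
complete `𝓘⁺` and an exhaustive `C²` decomposition into finitely many SUB-extremal boosted Kerr
near zones plus a flat radiation zone of `O = exteriorOf …`). -/
def Settles (D : InitialDataSet (𝓡 3) X) : Prop :=
  (∃ 𝒟 : VacuumCauchyDevelopment D, 𝒟.IsMaximal) ∧
    ∀ 𝒟 : VacuumCauchyDevelopment D, 𝒟.IsMaximal →
      Summit.FinalStateConjecture.HasCompleteNullInfinity 𝒟.toCauchyDevelopment ∧
        ∃ (O : Set 𝒟.carrier) (d : FinalStateDecomposition 𝒟.toSpacetime O 2),
          (∀ i, Kerr.IsSubextremal (d.mass i) (d.spin i)) ∧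
            O = Summit.FinalStateConjecture.exteriorOf 𝒟.toCauchyDevelopment d.charted ∧
              Summit.FinalStateConjecture.HasExhaustiveCharts d

end DataLevel

/-! ## §2 Window-level predicates of one development (honest configurations on the future
domain of outer communications; margin / parking; the two monotone charges) -/

section WindowLevel

variable [ConnectedSpace X] {D : InitialDataSet (𝓡 3) X}

/-- An `ε`-approximate `N`-Kerr configuration (in `C²`) on the chart-time window `[τ, τ + L]`,
near-zone radius `R`, of the intrinsic future domain of outer communications
`J⁺(ι X) ∩ J⁻(𝓘⁺)` (`DataEmbedding.outerRegion`) of the development `𝒟`. -/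
abbrev Config (𝒟 : VacuumCauchyDevelopment D) [𝒟.metric.HasLeviCivita] (ε : ℝ≥0∞)
    (τ L R : ℝ) : Type :=
  ApproximateKerrConfiguration 𝒟.toSpacetime 𝒟.toDataEmbedding.outerRegion 2 ε τ L R

/-- The **extremality gap** `χᵢ = 1 − aᵢ²/Mᵢ²` of hole `i` of a configuration (`> 0` by
`ApproximateKerrConfiguration.one_sub_sq_pos`; `χᵢ → 0` is parking at extremality). -/
def gap {𝒟 : VacuumCauchyDevelopment D} [𝒟.metric.HasLeviCivita] {ε : ℝ≥0∞} {τ L R : ℝ}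
    (c : Config 𝒟 ε τ L R) (i : Fin c.N) : ℝ :=
  1 - (c.spin i / c.mass i) ^ 2

/-- **Honest configurations** (the ones the predicates below quantify over): a non-degenerate
window `0 ≤ L`, every hole certified on a collar of unit width outside its horizon radius
(`r₊(Mᵢ, aᵢ) + 1 ≤ R`, so no hole rides on an empty truncated tube with junk parameters), and the
hole slabs at each window time jointly ACHRONAL (so no physical hole is listed twice through
time-shifted charts).  The structure `ApproximateKerrConfiguration` records no chart
compatibility, so without these clauses `N` and the parameters could be junk. -/
def IsHonest {𝒟 : VacuumCauchyDevelopment D} [𝒟.metric.HasLeviCivita] {ε : ℝ≥0∞} {τ L R : ℝ}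
    (c : Config 𝒟 ε τ L R) : Prop :=
  0 ≤ L ∧ (∀ i, Kerr.rPlus (c.mass i) (c.spin i) + 1 ≤ R) ∧
    ∀ σ ∈ Icc τ (τ + L), 𝒟.metric.IsAchronal 𝒟.timeOrientation
      (⋃ i, c.chart i '' (c.background i).truncTimeSlab R σ)

/-- `𝒟` **approaches the Kerr family along windows** (orbital form of settling, the route's
`QuietWindowApproach` for ONE development): for every tolerance `ε > 0`, window length `L ≥ 0`,
radius bound `R₁` and time `τ₀` there is an honest `ε`-configuration in `C²` of the future domain
of outer communications on some window `[τ, τ + L]`, `τ ≥ τ₀`, with near-zone radius `R ≥ R₁`. -/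
def Approaches (𝒟 : VacuumCauchyDevelopment D) [𝒟.metric.HasLeviCivita] : Prop :=
  ∀ ε : ℝ≥0∞, 0 < ε → ∀ L : ℝ, 0 ≤ L → ∀ R₁ τ₀ : ℝ,
    ∃ R, R₁ ≤ R ∧ ∃ τ, τ₀ ≤ τ ∧ ∃ c : Config 𝒟 ε τ L R, IsHonest c

/-- `𝒟` has an **extremality margin**: some `η > 0` bounds from below the gap of EVERY hole of
EVERY honest, sufficiently fine, sufficiently late configuration (no parking at extremality, in
the closed/quantitative form a capture statement on a compact spin range can consume). -/
def Margin (𝒟 : VacuumCauchyDevelopment D) [𝒟.metric.HasLeviCivita] : Prop :=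
  ∃ η : ℝ, 0 < η ∧ ∃ ε₀ : ℝ≥0∞, 0 < ε₀ ∧ ∃ τ₀ : ℝ,
    ∀ ε, ε ≤ ε₀ → ∀ τ, τ₀ ≤ τ → ∀ (L R : ℝ) (c : Config 𝒟 ε τ L R), IsHonest c →
      ∀ i, η ≤ gap c i

/-- `𝒟` **parks at extremality in the single-hole regime**: arbitrarily fine, arbitrarily late
honest ONE-hole configurations exhibit arbitrarily small gaps. -/
def ParksSingle (𝒟 : VacuumCauchyDevelopment D) [𝒟.metric.HasLeviCivita] : Prop :=
  ∀ η : ℝ, 0 < η → ∀ ε₀ : ℝ≥0∞, 0 < ε₀ → ∀ τ₀ : ℝ,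
    ∃ ε, ε ≤ ε₀ ∧ ∃ τ, τ₀ ≤ τ ∧ ∃ (L R : ℝ) (c : Config 𝒟 ε τ L R),
      IsHonest c ∧ c.N = 1 ∧ ∃ i, gap c i < η

/-- `𝒟` **parks at extremality in the multi-hole regime**: arbitrarily fine, arbitrarily late
honest configurations with AT LEAST TWO holes exhibit a hole with arbitrarily small gap.  (No card
on this crux has a mechanism against it; it is carried, declared, by `stub_fedOrMarginGeneric`.) -/
def ParksMulti (𝒟 : VacuumCauchyDevelopment D) [𝒟.metric.HasLeviCivita] : Prop :=
  ∀ η : ℝ, 0 < η → ∀ ε₀ : ℝ≥0∞, 0 < ε₀ → ∀ τ₀ : ℝ,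
    ∃ ε, ε ≤ ε₀ ∧ ∃ τ, τ₀ ≤ τ ∧ ∃ (L R : ℝ) (c : Config 𝒟 ε τ L R),
      IsHonest c ∧ 2 ≤ c.N ∧ ∃ i, gap c i < η

/-- `𝒟` is **starved** (the card's general-sector conclusion "the extremal Penrose inequality
holds at ALL pairs of times"): along every advanced-time foliation `A` of the intrinsic event
horizon `𝓗⁺ ∩ J⁺(ι X)` (`EventHorizonArea 𝒟 𝒟.completeNullRayRegion`) and every canonical
Bondi foliation `𝓕` (for any end `e`), `A_𝓗(v) ≤ 8π M_B(u)²` for all `v, u`. -/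
def Starved (𝒟 : VacuumCauchyDevelopment D) [𝒟.metric.HasLeviCivita] : Prop :=
  ∀ (A : EventHorizonArea 𝒟.toCauchyDevelopment 𝒟.completeNullRayRegion) (e : AFEnd X)
    (𝓕 : 𝒟.toDataEmbedding.BondiFoliation), 𝓕.IsCanonical e →
    ∀ v u : ℝ, A.horizonArea v ≤ ENNReal.ofReal (8 * Real.pi * 𝓕.bondiMass u ^ 2)

/-- `𝒟` is **fed at one instant** (the card's one-instant certificate): some cut of the event
horizon along some advanced-time foliation has finite area exceeding `8π M_B(u)²` for some cut `u`
of some canonical Bondi foliation — "`Θ = A_𝓗/(8π M_B²) > 1` once". -/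
def Fed (𝒟 : VacuumCauchyDevelopment D) [𝒟.metric.HasLeviCivita] : Prop :=
  ∃ (A : EventHorizonArea 𝒟.toCauchyDevelopment 𝒟.completeNullRayRegion) (e : AFEnd X)
    (𝓕 : 𝒟.toDataEmbedding.BondiFoliation), 𝓕.IsCanonical e ∧
    ∃ v u : ℝ, A.horizonArea v < ⊤ ∧
      ENNReal.ofReal (8 * Real.pi * 𝓕.bondiMass u ^ 2) < A.horizonArea v

/-- A fed development is not starved (one strict inequality against the universal bound). -/
theorem Fed.not_starved {𝒟 : VacuumCauchyDevelopment D} [𝒟.metric.HasLeviCivita] (hF : Fed 𝒟)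
    (hS : Starved 𝒟) : False := by
  obtain ⟨A, e, 𝓕, hc, v, u, -, hlt⟩ := hF
  exact absurd (hS A e 𝓕 hc v u) (not_le.2 hlt)

/-- **Pigeonhole.**  A development without margin parks, in the single-hole or in the multi-hole
regime (pure logic: a configuration witnessing a small gap has a hole, hence `N = 1` or `N ≥ 2`;
if both regimes eventually stopped witnessing small gaps, so would all honest configurations). -/
theorem parksSingle_or_parksMulti_of_not_margin {𝒟 : VacuumCauchyDevelopment D}
    [𝒟.metric.HasLeviCivita] (h : ¬ Margin 𝒟) : ParksSingle 𝒟 ∨ ParksMulti 𝒟 := by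
  by_contra hcon
  rw [not_or] at hcon
  obtain ⟨h1, h2⟩ := hcon
  simp only [ParksSingle, ParksMulti, not_forall, not_exists, not_and, not_lt, exists_prop]
    at h1 h2
  obtain ⟨η₁, hη₁, ε₁, hε₁, τ₁, H1⟩ := h1
  obtain ⟨η₂, hη₂, ε₂, hε₂, τ₂, H2⟩ := h2
  apply h
  refine ⟨min η₁ η₂, lt_min hη₁ hη₂, min ε₁ ε₂, lt_min hε₁ hε₂, max τ₁ τ₂, ?_⟩
  intro ε hε τ hτ L R c hc i
  have hN : 1 ≤ c.N := Nat.one_le_iff_ne_zero.2 (fun h0 ↦ (h0 ▸ i).elim0)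
  rcases Nat.eq_or_lt_of_le hN with hN1 | hN2
  · have := H1 ε (hε.trans (min_le_left _ _)) τ ((le_max_left _ _).trans hτ) L R c hc hN1.symm i
    exact (min_le_left _ _).trans this
  · have := H2 ε (hε.trans (min_le_right _ _)) τ ((le_max_right _ _).trans hτ) L R c hc hN2 i
    exact (min_le_right _ _).trans this

end WindowLevel

/-! ## §3 The four stub STATEMENTS (named `Prop`s; the registered `stub_*` theorems of §4 restate
them verbatim and `Registered.stub_*` are the name-keyed aliases used as hypotheses of
`CaptureSuffices_of`, the device of `Cruxes/SomeWindowSaving/Lines/inert-box-collapse.lean`) -/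

/-- STUB 1 · **QUIET WINDOW APPROACH** (the route's layer-2 node, one development at a time):
every maximal vacuum Cauchy development of a CENSORED admissible datum approaches the Kerr family
along windows (`Approaches`: honest `ε`-configurations in `C²` of the future domain of outer
communications exist arbitrarily late, for every `ε > 0`, `L ≥ 0` and radius bound).  Content:
no smooth non-Kerr stationary vacuum end state (rigidity beyond Alexakis–Ionescu–Klainerman /
analyticity), no eternal bound clusters, finitely many holes on late windows, `N = 0` included
(late `ε`-flatness of dispersing developments).  Consumes `W` only (through `Censored`).
Size XL / open-problem; shared in substance with the front-end items of routes QuietWindowCapture,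
KerrnessPropagates (`KerrBasinCapture`) and the `N = 0` cruxes of the summit. -/
def QuietWindowApproach : Prop :=
  ∀ (X : Type) [TopologicalSpace X] [ChartedSpace E3 X] [IsManifold (𝓡 3) ∞ X] [T2Space X]
    [SecondCountableTopology X] [ConnectedSpace X],
    ∀ D ∈ admissibleVacuumData X, Censored D →
      ∀ (𝒟 : VacuumCauchyDevelopment D) [𝒟.metric.HasLeviCivita], 𝒟.IsMaximal → Approaches 𝒟

/-- STUB 2 · **PARKING STARVES THE HOLE** (the card's lever, general sector; load-bearing: it is
the only link from the one-instant certificate `Fed` to the margin): a censored MGHD of an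
admissible datum that approaches the Kerr family along windows and parks at extremality in the
single-hole regime is STARVED — `A_𝓗(v) ≤ 8π M_B(u)²` for every advanced-time foliation of the
event horizon, every canonical Bondi foliation and every pair `(v, u)`.  Intended proof: (a) area
theorem (tree, from the named facts `ChruscielEtAl2001_areaTheorem` +
`HawkingEllis1973_achronalBoundary`:
`VacuumCauchyDevelopment.monotone_horizonArea_of_achronalBoundary`; complete generators
from censorship) and Bondi mass loss (`IsCanonical.bondiMass_antitone`), so `A_𝓗(v) ≤ A_∞`,
`M_B(u) ≥ M_B(∞)`; (b) the two IDENTIFICATIONS along the parking windows —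
`A_∞ = lim 8π Mₙ r₊(Mₙ, aₙ) = 8π M_f²` (lower bound: outermost MOTS of the tracked slices is
outer-minimising inside a mean-convex Kerr–Schild sphere foliation, kit j009890 of triage r1-2, and `MOTS ⊂ 𝓑` under
censorship; upper bound: the horizon cut lies below every visible coordinate sphere `r = r₊ + δ` of
the honest collar, whose areas are `8π M r₊ + O(δ) + O(ε)`) and `M_B(∞) ≥ M_f` (no energy other
than the hole's survives in the Bondi mass: positivity of the Bondi energy–momentum in the hole's
rest frame); (c) compact horizon sections have finite area (CDGH Prop. 3.4).  No decay rate, no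
transversal derivative on `𝓗⁺`, no localisation of the horizon by the red shift (which
degenerates on the parking stratum) is needed — only AREAS and their limits.  MODEL-SECTOR
STRENGTHENING (not registered, recorded for the lead): for axisymmetric data Komar's `J` is
conserved, every late outermost MOTS obeys the Dain–Reiris/Jaramillo–Reiris–Dain floor
`A ≥ 8π|J|` (arXiv:1102.5215, arXiv:1106.3743; rigidity Gabach-Clément–Jaramillo–Reiris
arXiv:1207.6761) and `A_∞ = 8π|J|`, so `saturation_of_monotone_floor_limit` (card, PROVED) makes
`A_𝓗` CONSTANT after a finite advanced time: the parked hole's event horizon is exactly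
non-expanding (`θ ≡ σ ≡ 0`, vacuum Raychaudhuri) — "the hole must stop eating".  Size M/L. -/
def ParkingStarves : Prop :=
  ∀ (X : Type) [TopologicalSpace X] [ChartedSpace E3 X] [IsManifold (𝓡 3) ∞ X] [T2Space X]
    [SecondCountableTopology X] [ConnectedSpace X],
    ∀ D ∈ admissibleVacuumData X, Censored D →
      ∀ (𝒟 : VacuumCauchyDevelopment D) [𝒟.metric.HasLeviCivita], 𝒟.IsMaximal →
        Approaches 𝒟 → ParksSingle 𝒟 → Starved 𝒟

/-- STUB 3 · **FED OR MARGIN IS GENERIC** (the genericity leg; it is where `W`'s curves, the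
unparking KICK and the ∧-gap of curve-genericity are spent): granted the two capture statements
and weak cosmic censorship, Christodoulou-generic admissible data are censored AND every MGHD
either has an extremality margin outright or is fed at one instant, AND does not park in the
multi-hole regime.  Intended mechanism (cards kick-lifts-the-slice-edge,
capture-exports-censorship-diagonal-surgery, extremality-gauge-theta): through a censored datum
whose MGHD parks passes the admissible family `c ↦ d + (receding spinless pulse of energy ∝ c²)`;
absorbed spinless energy `δE` at gap `χ` raises `Θ = A_𝓗/(8π M_B²)` by `≍ δE/(κM²) ≫ δE` while
`M_B` already contains the in-flight energy, so the member is `Fed`; members are censored by the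
far-complete `𝓘⁺` of capture transferred along the quiet-past adapter; the ∧ with `W`'s curve is
the diagonal two-parameter surgery lemma (smooth flat selector `e(c)`).  DECLARED GAP: no card has
a mechanism in the multi-hole regime (`¬ ParksMulti` rides here without one; the per-lineage
budget form of Stub 2 — `M_B(u) ≥ √(Mᵢ r₊,ᵢ) + Σ_{j≠i} m_irr,j` for a parking lineage — is the
lead's first reshaping option, `HorizonLineage.lean`).  Size L/XL. -/
def FedOrMarginGeneric : Prop :=
  PhaseMixingCapture.NearExtremalKappaCapture → PhaseMixingCapture.BulkKerrCapture →
    PhaseMixingCapture.WeakCosmicCensorshipMGHD →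
    ∀ (X : Type) [TopologicalSpace X] [ChartedSpace E3 X] [IsManifold (𝓡 3) ∞ X] [T2Space X]
      [SecondCountableTopology X] [ConnectedSpace X],
      InitialDataSet.IsChristodoulouGeneric (admissibleVacuumData X)
        (fun D ↦ Censored D ∧ ∀ (𝒟 : VacuumCauchyDevelopment D) [𝒟.metric.HasLeviCivita],
          𝒟.IsMaximal → (Margin 𝒟 ∨ Fed 𝒟) ∧ ¬ ParksMulti 𝒟) 1

/-- STUB 4 · **MARGIN CAPTURE** (conversion of orbital closeness WITH MARGIN into settling; the
only stub that consumes the capture hypotheses): granted `NearExtremalKappaCapture` and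
`BulkKerrCapture`, a censored admissible datum all of whose MGHDs approach the Kerr family along
windows with an extremality margin SETTLES (verbatim the summit's `∀`-MGHD clauses: complete `𝓘⁺`,
exhaustive `C²` decomposition into sub-extremal holes, `O = exteriorOf …`).  With a margin `η` the
bulk statement at `a₁ = √(1 − η/2)` suffices (the `κ`-power basin of `NearExtremalKappaCapture`
is idle in THIS line — disclosed; it is kept as a hypothesis so a prover may use it).
STANDING-DISPROOF CAVEATS (Disproof.lean §B `captureSuffices_iff_sharp`, §D mass pinning; triage
X3/C3): as typed the capture hypotheses arrive at adversarial witnesses (`k = 0`, `δ ≥ δ₀`), and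
no honest late slab of a radiating development lies in any `H^s_δ` basin with `δ ≥ −1/2` (old
light; Kerr–Schild `tr k ≍ 2M/r²` tail) — so this stub is provable only through the QUIET-PAST
ADAPTER of card quiet-past-cone-surgery (auxiliary datum whose MGHD shares the future set of a late
outgoing cone; reach `δ < 1/2`) together with the owner's announced numeral repair (`k := 2`,
`δ` pinned), or after the capture items are re-seated on windows; its `N = 0` sub-case needs
small-data Minkowski capture (Christodoulou–Klainerman 1993), which is NOT among the crux's
hypotheses (triage r1-3 (d)); `N ≥ 2` needs per-hole capture under the other holes' decaying tidal
field.  Size L/XL (the content of route QuietWindowCapture's capture node). -/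
def MarginCapture : Prop :=
  PhaseMixingCapture.NearExtremalKappaCapture → PhaseMixingCapture.BulkKerrCapture →
    ∀ (X : Type) [TopologicalSpace X] [ChartedSpace E3 X] [IsManifold (𝓡 3) ∞ X] [T2Space X]
      [SecondCountableTopology X] [ConnectedSpace X],
      ∀ D ∈ admissibleVacuumData X, Censored D →
        (∀ (𝒟 : VacuumCauchyDevelopment D) [𝒟.metric.HasLeviCivita], 𝒟.IsMaximal →
          Approaches 𝒟 ∧ Margin 𝒟) → Settles D

/-! ## §4 The registered stubs (`sorry` lives only in these four theorems) -/

/-- **STUB 1 · `stub_quietWindowApproach`** = `QuietWindowApproach` verbatim (see its docstring). -/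
theorem stub_quietWindowApproach :
    ∀ (X : Type) [TopologicalSpace X] [ChartedSpace E3 X] [IsManifold (𝓡 3) ∞ X] [T2Space X]
      [SecondCountableTopology X] [ConnectedSpace X],
      ∀ D ∈ admissibleVacuumData X, Censored D →
        ∀ (𝒟 : VacuumCauchyDevelopment D) [𝒟.metric.HasLeviCivita], 𝒟.IsMaximal →
          Approaches 𝒟 := by
  sorry

/-- **STUB 2 · `stub_parkingStarves`** = `ParkingStarves` verbatim (the lever; see its
docstring). -/
theorem stub_parkingStarves :
    ∀ (X : Type) [TopologicalSpace X] [ChartedSpace E3 X] [IsManifold (𝓡 3) ∞ X] [T2Space X]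
      [SecondCountableTopology X] [ConnectedSpace X],
      ∀ D ∈ admissibleVacuumData X, Censored D →
        ∀ (𝒟 : VacuumCauchyDevelopment D) [𝒟.metric.HasLeviCivita], 𝒟.IsMaximal →
          Approaches 𝒟 → ParksSingle 𝒟 → Starved 𝒟 := by
  sorry

/-- **STUB 3 · `stub_fedOrMarginGeneric`** = `FedOrMarginGeneric` verbatim (see its docstring). -/
theorem stub_fedOrMarginGeneric :
    PhaseMixingCapture.NearExtremalKappaCapture → PhaseMixingCapture.BulkKerrCapture →
      PhaseMixingCapture.WeakCosmicCensorshipMGHD →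
      ∀ (X : Type) [TopologicalSpace X] [ChartedSpace E3 X] [IsManifold (𝓡 3) ∞ X] [T2Space X]
        [SecondCountableTopology X] [ConnectedSpace X],
        InitialDataSet.IsChristodoulouGeneric (admissibleVacuumData X)
          (fun D ↦ Censored D ∧ ∀ (𝒟 : VacuumCauchyDevelopment D) [𝒟.metric.HasLeviCivita],
            𝒟.IsMaximal → (Margin 𝒟 ∨ Fed 𝒟) ∧ ¬ ParksMulti 𝒟) 1 := by
  sorry

/-- **STUB 4 · `stub_marginCapture`** = `MarginCapture` verbatim (see its docstring). -/
theorem stub_marginCapture :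
    PhaseMixingCapture.NearExtremalKappaCapture → PhaseMixingCapture.BulkKerrCapture →
      ∀ (X : Type) [TopologicalSpace X] [ChartedSpace E3 X] [IsManifold (𝓡 3) ∞ X] [T2Space X]
        [SecondCountableTopology X] [ConnectedSpace X],
        ∀ D ∈ admissibleVacuumData X, Censored D →
          (∀ (𝒟 : VacuumCauchyDevelopment D) [𝒟.metric.HasLeviCivita], 𝒟.IsMaximal →
            Approaches 𝒟 ∧ Margin 𝒟) → Settles D := by
  sorry

/-! ### Consistency: each named statement IS its registered stub (definitionally) -/

theorem quietWindowApproach_holds : QuietWindowApproach := stub_quietWindowApproach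
theorem parkingStarves_holds : ParkingStarves := stub_parkingStarves
theorem fedOrMarginGeneric_holds : FedOrMarginGeneric := stub_fedOrMarginGeneric
theorem marginCapture_holds : MarginCapture := stub_marginCapture

/-! ### Name-keyed aliases of the four statements (the hypotheses of the composition) -/
namespace Registered

/-- Alias of `QuietWindowApproach` keyed by the registered stub name. -/
abbrev stub_quietWindowApproach : Prop := QuietWindowApproach
/-- Alias of `ParkingStarves` keyed by the registered stub name. -/
abbrev stub_parkingStarves : Prop := ParkingStarves
/-- Alias of `FedOrMarginGeneric` keyed by the registered stub name. -/
abbrev stub_fedOrMarginGeneric : Prop := FedOrMarginGeneric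
/-- Alias of `MarginCapture` keyed by the registered stub name. -/
abbrev stub_marginCapture : Prop := MarginCapture

end Registered

/-! ## §5a Scalar cores of Stub 2 (PROVED; what its two identifications must deliver) -/

section ScalarCores

/-- The Kerr horizon area `A = 4π(r₊² + a²) = 8π M r₊` is at least the extremal value `8π M²`. -/
theorem kerrArea_ge {M : ℝ} (hM : 0 ≤ M) (a : ℝ) :
    8 * Real.pi * M ^ 2 ≤ 8 * Real.pi * (M * Kerr.rPlus M a) := by
  have h : M ≤ Kerr.rPlus M a := by
    unfold Kerr.rPlus
    linarith [Real.sqrt_nonneg (M ^ 2 - a ^ 2)]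
  have h8 : (0 : ℝ) ≤ 8 * Real.pi := by positivity
  calc 8 * Real.pi * M ^ 2 = 8 * Real.pi * (M * M) := by ring
    _ ≤ 8 * Real.pi * (M * Kerr.rPlus M a) :=
        mul_le_mul_of_nonneg_left (mul_le_mul_of_nonneg_left h hM) h8

/-- … with equality exactly at extremality: for `0 < M`, `|a| ≤ M`,
`8π M r₊(M, a) = 8π M²  ↔  |a| = M` (the card's `kerr_area_eq_eightPiAbsJ_iff` in the form used
here: PARKING ⇔ the limiting horizon area sits on the extremal value `8π M_f²`). -/
theorem kerrArea_eq_iff {M a : ℝ} (hM : 0 < M) (ha : |a| ≤ M) :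
    8 * Real.pi * (M * Kerr.rPlus M a) = 8 * Real.pi * M ^ 2 ↔ |a| = M := by
  have h8 : (0 : ℝ) < 8 * Real.pi := by positivity
  constructor
  · intro h
    have h1 : M * Kerr.rPlus M a = M ^ 2 := by
      have := mul_left_cancel₀ h8.ne' h
      simpa using this
    have h2 : Kerr.rPlus M a = M := by
      have : M * Kerr.rPlus M a = M * M := by rw [h1]; ring
      exact mul_left_cancel₀ hM.ne' this
    have h3 : √(M ^ 2 - a ^ 2) = 0 := by unfold Kerr.rPlus at h2; linarith
    have h4 : M ^ 2 - a ^ 2 ≤ 0 := by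
      by_contra hcon
      push Not at hcon
      exact (Real.sqrt_pos.2 hcon).ne' h3
    have h5 : M ≤ |a| := by
      rw [← Real.sqrt_sq hM.le, ← Real.sqrt_sq_eq_abs]
      exact Real.sqrt_le_sqrt (by linarith)
    exact le_antisymm ha h5
  · intro h
    have h1 : M ^ 2 - a ^ 2 = 0 := by rw [← sq_abs a, h]; ring
    unfold Kerr.rPlus
    rw [h1, Real.sqrt_zero, add_zero]
    ring

/-- **The general-sector starvation core** (pure order bookkeeping): if every horizon cut area
is below a limiting value `A∞`, every Bondi mass is above a limiting value `M∞ ≥ 0`, and the two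
limits PINCH, `A∞ ≤ 8π M∞²` (parking: `A∞ = 8π M_f r₊ = 8π M_f²` by `kerrArea_eq_iff`, and
`M∞ ≥ M_f`), then `A(v) ≤ 8π M(u)²` at every pair of cuts — the conclusion `Starved`.  Stub 2 is
exactly: supply `A∞`, `M∞` and the pinch for a parking development (area theorem, Bondi loss, and
the two identifications of its docstring). -/
theorem starved_core {A : ℝ → ℝ≥0∞} {Mb : ℝ → ℝ} {Ainf : ℝ≥0∞} {Minf : ℝ}
    (hA : ∀ v, A v ≤ Ainf) (hM : ∀ u, Minf ≤ Mb u) (hMinf : 0 ≤ Minf)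
    (hpinch : Ainf ≤ ENNReal.ofReal (8 * Real.pi * Minf ^ 2)) :
    ∀ v u, A v ≤ ENNReal.ofReal (8 * Real.pi * Mb u ^ 2) := by
  intro v u
  refine (hA v).trans (hpinch.trans (ENNReal.ofReal_le_ofReal ?_))
  have h8 : (0 : ℝ) ≤ 8 * Real.pi := by positivity
  exact mul_le_mul_of_nonneg_left (pow_le_pow_left₀ hMinf (hM u) 2) h8

/-- **The one-instant certificate, quantitatively** (contrapositive core): if some cut is fed,
`8π M(u₁)² < A(v₁)`, while `A ≤ A∞ = 8π M_f r₊(M_f, a_f)` and `M_f ≤ M(u₁)` with `0 < M_f`,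
`|a_f| ≤ M_f`, then the final hole is NOT extremal: `|a_f| < M_f`. -/
theorem not_extremal_of_fed {A : ℝ → ℝ≥0∞} {Mb : ℝ → ℝ} {Mf af v₁ u₁ : ℝ} (hMf : 0 < Mf)
    (haf : |af| ≤ Mf) (hA : ∀ v, A v ≤ ENNReal.ofReal (8 * Real.pi * (Mf * Kerr.rPlus Mf af)))
    (hM : Mf ≤ Mb u₁) (hfed : ENNReal.ofReal (8 * Real.pi * Mb u₁ ^ 2) < A v₁) : |af| < Mf := by
  rcases lt_or_eq_of_le haf with h | h
  · exact h
  · exfalso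
    have hpinch : ENNReal.ofReal (8 * Real.pi * (Mf * Kerr.rPlus Mf af)) ≤
        ENNReal.ofReal (8 * Real.pi * Mf ^ 2) := by rw [(kerrArea_eq_iff hMf haf).2 h]
    have := starved_core hA (fun u ↦ (hM : Mf ≤ (fun _ ↦ Mb u₁) u)) hMf.le hpinch v₁ u₁
    exact absurd this (not_le.2 hfed)

end ScalarCores

/-! ## §5 Proved glue -/

section Glue

variable {E : Type*} [NormedAddCommGroup E] [NormedSpace ℝ E] {H : Type*} [TopologicalSpace H]
  {I : ModelWithCorners ℝ E H} {Y : Type*} [TopologicalSpace Y] [ChartedSpace H Y]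
  [IsManifold I ∞ Y]

/-- Christodoulou's curve-genericity is monotone in the property (on the admissible class).
(Same three lines as `Disproof.isChristodoulouGeneric_mono`; re-proved to keep the skeleton's
imports to the route file and the Literature.) -/
theorem isChristodoulouGeneric_mono {𝓓 : Set (InitialDataSet I Y)}
    {P Q : InitialDataSet I Y → Prop} (hPQ : ∀ d ∈ 𝓓, P d → Q d) {m : ℕ}
    (h : InitialDataSet.IsChristodoulouGeneric 𝓓 P m) :
    InitialDataSet.IsChristodoulouGeneric 𝓓 Q m := by
  intro d hd
  obtain ⟨F, hF, h0, hinj, hadm, hexc⟩ := h d ⟨hd.1, fun hP ↦ hd.2 (hPQ d hd.1 hP)⟩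
  exact ⟨F, hF, h0, hinj, hadm,
    fun c hc hmem ↦ hexc c hc ⟨hmem.1, fun hP ↦ hmem.2 (hPQ _ hmem.1 hP)⟩⟩

end Glue

section Pointwise

variable [T2Space X] [SecondCountableTopology X] [ConnectedSpace X]

/-- **The pointwise half of the line**: for an admissible censored datum whose every MGHD is
fed-or-has-margin and does not park in the multi-hole regime, stubs 1, 2 and 4 give settling.
(Per MGHD: approach by Stub 1; if there is no margin, the pigeonhole puts the development in the
single-hole parking regime, Stub 2 starves it, contradicting `Fed`; so there is a margin, and
Stub 4 converts it.) -/
theorem settles_of_fedOrMargin (h1 : QuietWindowApproach) (h2 : ParkingStarves)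
    (h4 : MarginCapture) (hNear : PhaseMixingCapture.NearExtremalKappaCapture)
    (hBulk : PhaseMixingCapture.BulkKerrCapture)
    {D : InitialDataSet (𝓡 3) X} (hD : D ∈ admissibleVacuumData X) (hC : Censored D)
    (hFM : ∀ (𝒟 : VacuumCauchyDevelopment D) [𝒟.metric.HasLeviCivita], 𝒟.IsMaximal →
      (Margin 𝒟 ∨ Fed 𝒟) ∧ ¬ ParksMulti 𝒟) :
    Settles D := by
  refine h4 hNear hBulk X D hD hC fun 𝒟 _ h𝒟 ↦ ?_
  have hA : Approaches 𝒟 := h1 X D hD hC 𝒟 h𝒟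
  obtain ⟨hmf, hmulti⟩ := hFM 𝒟 h𝒟
  refine ⟨hA, ?_⟩
  rcases hmf with hm | hfed
  · exact hm
  · by_contra hm
    rcases parksSingle_or_parksMulti_of_not_margin hm with hs | hmu
    · exact hfed.not_starved (h2 X D hD hC 𝒟 h𝒟 hA hs)
    · exact hmulti hmu

end Pointwise

/-! ## §6 The composition: the four stubs imply the crux, BY NAME (kernel-checked; no `sorry`
below this line) -/

/-- **`CaptureSuffices_of`** — the glue of the line: genericity of `Censored ∧ (fed-or-margin ∧
no multi-hole parking)` (Stub 3, which spends `W`) is transported to genericity of settling by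
monotonicity of Christodoulou genericity along the pointwise implication `settles_of_fedOrMargin`
(Stubs 1, 2, 4, which spend the capture statements). -/
theorem CaptureSuffices_of (h1 : Registered.stub_quietWindowApproach)
    (h2 : Registered.stub_parkingStarves) (h3 : Registered.stub_fedOrMarginGeneric)
    (h4 : Registered.stub_marginCapture) : PhaseMixingCapture.CaptureSuffices := by
  intro hNear hBulk hW X _ _ _ _ _ _
  refine isChristodoulouGeneric_mono (fun D hD hP ↦ ?_) (h3 hNear hBulk hW X)
  obtain ⟨hC, hFM⟩ := hP
  exact settles_of_fedOrMargin h1 h2 h4 hNear hBulk hD hC hFM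

/-- Wiring check: the registered stubs feed `CaptureSuffices_of` as stated. -/
example : PhaseMixingCapture.CaptureSuffices :=
  CaptureSuffices_of stub_quietWindowApproach stub_parkingStarves stub_fedOrMarginGeneric
    stub_marginCapture

/-! ## §7 Sanity (sorry-free): the summit implies every stub's CONCLUSION shape it should, and
the predicates are not vacuous in the trivial directions -/

/-- `Settles` IS the matrix of the summit statement: the final state conjecture says verbatim
that settling is Christodoulou-generic (codimension 1) on every admissible class. -/
theorem finalStateConjecture_iff_settles_generic :
    FinalStateConjecture ↔
      ∀ (X : Type) [TopologicalSpace X] [ChartedSpace E3 X] [IsManifold (𝓡 3) ∞ X] [T2Space X]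
        [SecondCountableTopology X] [ConnectedSpace X],
        InitialDataSet.IsChristodoulouGeneric (admissibleVacuumData X) Settles 1 :=
  Iff.rfl

/-- `Censored` IS the matrix of the route's censorship item. -/
theorem weakCosmicCensorshipMGHD_iff_censored_generic :
    PhaseMixingCapture.WeakCosmicCensorshipMGHD ↔
      ∀ (X : Type) [TopologicalSpace X] [ChartedSpace E3 X] [IsManifold (𝓡 3) ∞ X] [T2Space X]
        [SecondCountableTopology X] [ConnectedSpace X],
        InitialDataSet.IsChristodoulouGeneric (admissibleVacuumData X) Censored 1 :=
  Iff.rfl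

/-- The summit statement implies the crux (so the crux, and with it the conjunction of the four
stubs' CONCLUSION, is refutable only through `¬ FinalStateConjecture`; cf. Disproof §E). Kept an
`example` so that `CaptureSuffices_of` stays the only theorem of the file concluding the crux. -/
example (h : FinalStateConjecture) : PhaseMixingCapture.CaptureSuffices := fun _ _ _ ↦ h

/-- Settling data are censored (the first `∀`-MGHD conjunct). -/
theorem Censored.of_settles [ConnectedSpace X] {D : InitialDataSet (𝓡 3) X} (h : Settles D) :
    Censored D :=
  ⟨h.1, fun 𝒟 h𝒟 ↦ (h.2 𝒟 h𝒟).1⟩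

/-- A development with a margin does not park in either regime (so Stub 2 is never applied to a
development that Stub 4 can already consume). -/
theorem Margin.not_parksSingle [ConnectedSpace X] {D : InitialDataSet (𝓡 3) X}
    {𝒟 : VacuumCauchyDevelopment D} [𝒟.metric.HasLeviCivita] (h : Margin 𝒟)
    (hp : ParksSingle 𝒟) : False := by
  obtain ⟨η, hη, ε₀, hε₀, τ₀, H⟩ := h
  obtain ⟨ε, hε, τ, hτ, L, R, c, hc, -, i, hi⟩ := hp η hη ε₀ hε₀ τ₀
  exact absurd (H ε hε τ hτ L R c hc i) (not_le.2 hi)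

end Summit.FinalStateConjecture.FinalStateConjecture.Cruxes.CaptureSuffices.ParkingStarvesTheHole

end
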